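import Literature.Topology.FourManifolds.OneHandlebodyBasin
import Literature.Topology.FourManifolds.OneHandlebodyFundamentalGroup
import Literature.Topology.FourManifolds.RegularIntervalBoundary
import Literature.Topology.FourManifolds.LeftHandDiscCollar
import Literature.Topology.FourManifolds.GradientLikeTurnAbout
import Literature.Topology.FourManifolds.SlabHittingTime
import HarnessLib

/-!
# The basin of the `0`-handle of a compact manifold with boundary: the setting for the level
# conjugation of boundary diffeomorphisms (Torelli half of Griffiths' theorem, endgame)

Topic `Literature/Topology/FourManifolds`; infrastructure for the Torelli criterion of Griffiths'
handlebody extension theorem (`HandlebodyKernelExtensionTorelli.lean`), endgame step: *a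
self-diffeomorphism of `∂W` which is the identity near the traces of the co-cores extends over
`W`* — by conjugating it, level by level, along the trajectories of a gradient-like field
through the basin of the `0`-handle, and extending radially inside the Morse chart of the
minimum.  Everything here is **proved**; this file only fixes the data.

Let `W` be a compact manifold with boundary, `g` a Morse function on the triad `(W; ∅, ∂W)`
(`Cobordism.ofBoundary`; Milnor 1965, Def. 3.1: `g = 1` exactly on `∂W`, regular there) with a
smooth gradient-like field `ξ` and a unique critical point `p₀` of index `0`.
`Literature.Topology.FourManifolds.BasinSetting g ξ` packages, once and for all:

* `S` — a collar setting of `∂W` for the turned-about data `(1 - g, -ξ)`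
  (`Cobordism.CollarSetting`, `LeftHandDiscCollar.lean`: flow-out of the normalised field from
  the boundary, Milnor's `ψ_y(s)`), with all critical values below the collar level `1 - a'`;
* `θ` — the global smooth flow of the field cut off to the slab
  `g⁻¹[g p₀ / 2, 1 - pushConst · a'/4]` (`Cobordism.SlabFlow`, `SlabDynamics.lean`), a slab
  which contains every critical point and the push level `1 - pushConst · a'/2` of the cover
  of height `a'` (`RegularIntervalBoundary.lean`);
* `φ`, `r₀` — Milnor's chart at `p₀` (`IsGradientLike.exists_chart_morseIndex`, index `0`:
  `g = g p₀ + ‖u - u₀‖²`, `ξ = u - u₀` radial) and a radius such that the closed chart ball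
  lies in the target, the sublevel set `{g ≤ g p₀ + r₀²}` lies in the chart domain, and the level
  `g p₀ + r₀²` is below every other critical value and below the collar.

`BasinSetting.nonempty` constructs such data from `(g, ξ, p₀)` (the chart part as in
`IsMorseAdapted.exists_chart_sublevel_eq_closedBall_of_index_zero`,
`OneHandlebodyFundamentalGroup.lean`, but for Milnor's chart, in which the field is radial as
well); the rest of the file is first bookkeeping (the strict minimum, the sublevel balls).

## References

* J. Milnor, *Lectures on the h-cobordism theorem*, notes by L. Siebenmann and J. Sondow,
  Princeton Mathematical Notes (1965): Def. 3.1, proof of Thm. 3.4 (PDF pp. 11–13), Def. 3.9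
  (PDF p. 16), Thm. 4.1 (PDF p. 22). [MilnorHCobordism1965]
* J. Milnor, *Morse theory* (1963), Lemma 2.2, Thm. 3.1, proof of Thm. 4.1 (p. 25). [Milnor1963]
* H. B. Griffiths, *Automorphisms of a 3-dimensional handlebody*, Abh. Math. Sem. Univ. Hamburg
  26 (1964), §§3–6. [GriffithsHB1964Handlebody]
-/

open scoped Manifold ContDiff Topology
open Set Function Filter Metric

noncomputable section

namespace Literature.Topology.FourManifolds

open Cobordism FourManifolds.Flow

universe u

variable {n : ℕ} {W : Type u} [TopologicalSpace W] [T2Space W] [SecondCountableTopology W]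
  [CompactSpace W] [ChartedSpace (EuclideanHalfSpace (n + 1)) W] [IsManifold (𝓡∂ (n + 1)) ∞ W]

/-- **The basin setting** of a compact manifold with boundary `W` carrying a Morse function `g`
on `(W; ∅, ∂W)` with a smooth gradient-like field `ξ` and a unique critical point `p₀` of index
`0`: a collar of `∂W` for the turned-about data with the critical values below it, the slab
flow of the cut-off field on a slab containing all critical points and the push level, and
Milnor's radial chart at `p₀` with a small radius.  See the module docstring.
[cite: MilnorHCobordism1965, Def. 3.1, proof of Thm. 3.4, Def. 3.9 (PDF pp. 11–16)] -/
structure BasinSetting (g : W → ℝ) (ξ : Π x : W, TangentSpace (𝓡∂ (n + 1)) x) where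
  /-- `g` is a Morse function on the triad `(W; ∅, ∂W)` -/
  isMorseFunction : (Cobordism.ofBoundary n W).IsMorseFunction g
  /-- `ξ` is smooth -/
  contMDiff : ContMDiff (𝓡∂ (n + 1)) (𝓡∂ (n + 1)).tangent ∞
    fun x => (⟨x, ξ x⟩ : TangentBundle (𝓡∂ (n + 1)) W)
  /-- `ξ` is gradient-like for `g` -/
  isGradientLike : IsGradientLike (𝓡∂ (n + 1)) g ξ
  /-- the collar setting of `∂W`, for the turned-about data `(1 - g, -ξ)` -/
  S : CollarSetting (Cobordism.ofBoundary n W).symm (fun z => 1 - g z) (fun z => -ξ z)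
  /-- the critical values lie below the collar level `1 - a'` -/
  crit_lt : ∀ p, IsMCriticalPt (𝓡∂ (n + 1)) g p → g p < 1 - S.a'
  /-- the minimum -/
  p₀ : W
  /-- the collar parameter is below the minimum value -/
  a'_lt_apply_p₀ : S.a' < g p₀
  /-- `p₀` is the unique critical point of index `0` -/
  criticalSetOfIndex_zero : criticalSetOfIndex (𝓡∂ (n + 1)) g 0 = {p₀}
  /-- the slab flow -/
  θ : ℝ × W → W
  /-- `θ` is the slab flow on `[g p₀ / 2, 1 - pushConst · a' / 4]` -/
  slabFlow : SlabFlow (Cobordism.ofBoundary n W) g ξ (g p₀ / 2) (1 - pushConst * S.a' / 4) θ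
  /-- Milnor's chart at `p₀` -/
  φ : OpenPartialHomeomorph W (EuclideanHalfSpace (n + 1))
  /-- the chart belongs to the maximal atlas -/
  φ_mem : φ ∈ IsManifold.maximalAtlas (𝓡∂ (n + 1)) ∞ W
  /-- `p₀` lies in the chart domain -/
  p₀_mem : p₀ ∈ φ.source
  /-- in the chart `g = g p₀ + ‖u - u₀‖²` -/
  g_eq : ∀ q ∈ φ.source,
    g q = g p₀ + ‖φ.extend (𝓡∂ (n + 1)) q - φ.extend (𝓡∂ (n + 1)) p₀‖ ^ 2
  /-- in the chart `ξ` is the radial field `u - u₀` -/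
  ξ_eq : ∀ q ∈ φ.source, mfderiv (𝓡∂ (n + 1)) 𝓘(ℝ, EuclideanSpace ℝ (Fin (n + 1)))
    (φ.extend (𝓡∂ (n + 1))) q (ξ q) = φ.extend (𝓡∂ (n + 1)) q - φ.extend (𝓡∂ (n + 1)) p₀
  /-- the radius of the chart ball -/
  r₀ : ℝ
  /-- the radius is positive -/
  r₀_pos : 0 < r₀
  /-- the closed chart ball lies in the target of the extended chart -/
  closedBall_subset : closedBall (φ.extend (𝓡∂ (n + 1)) p₀) r₀ ⊆ (φ.extend (𝓡∂ (n + 1))).target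
  /-- the sublevel set `{g ≤ g p₀ + r₀²}` lies in the chart domain -/
  sublevel_subset : g ⁻¹' Iic (g p₀ + r₀ ^ 2) ⊆ φ.source
  /-- the top of the chart ball lies below every other critical value -/
  lt_of_isMCriticalPt : ∀ p, IsMCriticalPt (𝓡∂ (n + 1)) g p → p ≠ p₀ → g p₀ + r₀ ^ 2 < g p
  /-- ... and below the collar -/
  level_lt : g p₀ + r₀ ^ 2 < 1 - S.a'

namespace BasinSetting

variable {g : W → ℝ} {ξ : Π x : W, TangentSpace (𝓡∂ (n + 1)) x}

/-! ### Existence -/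

omit [T2Space W] [SecondCountableTopology W] [CompactSpace W] [IsManifold (𝓡∂ (n + 1)) ∞ W] in
/-- Milnor's quadratic form of index `0` is `‖u‖²`. [cite: MilnorHCobordism1965, Def. 3.1 (λ = 0)] -/
theorem milnorQuadratic_index_zero {m : ℕ} (u : EuclideanSpace ℝ (Fin m)) :
    milnorQuadratic 0 u = ‖u‖ ^ 2 := by
  rw [milnorQuadratic_eq_sum, EuclideanSpace.real_norm_sq_eq]
  refine Finset.sum_congr rfl fun i _ => ?_
  simp

/-- **Basin settings exist** for a Morse function on `(W; ∅, ∂W)` with a smooth gradient-like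
field and a unique critical point of index `0`. [cite: MilnorHCobordism1965, Def. 3.1, proof of Thm. 3.4 (PDF pp. 11–13)] [cite: Milnor1963, proof of Thm. 4.1 (p. 25)] -/
theorem nonempty (hg : (Cobordism.ofBoundary n W).IsMorseFunction g)
    (hξs : ContMDiff (𝓡∂ (n + 1)) (𝓡∂ (n + 1)).tangent ∞
      fun x => (⟨x, ξ x⟩ : TangentBundle (𝓡∂ (n + 1)) W))
    (hξ : IsGradientLike (𝓡∂ (n + 1)) g ξ) {p₀ : W}
    (hp₀ : criticalSetOfIndex (𝓡∂ (n + 1)) g 0 = {p₀}) : Nonempty (BasinSetting g ξ) := by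
  classical
  have hgA : IsMorseAdapted (𝓡∂ (n + 1)) g := hg.isMorseAdapted_ofBoundary
  have hcont : Continuous g := hg.isMorse.contMDiff.continuous
  -- room around the critical values, and the collar of `∂W`
  obtain ⟨β, hβ, -, hβg'⟩ := hg.exists_margin
  have hβg : ∀ p, IsMCriticalPt (𝓡∂ (n + 1)) g p → 2 * β < g p ∧ g p < 1 - 2 * β := fun p hp => hβg' p hp
  have hξs' : ContMDiff (𝓡∂ (n + 1)) (𝓡∂ (n + 1)).tangent ∞
      fun x => (⟨x, (fun z => -ξ z) x⟩ : TangentBundle (𝓡∂ (n + 1)) W) := hξs.neg_section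
  obtain ⟨S, hSβ⟩ := Cobordism.IsMorseFunction.exists_collarSetting
    (c := (Cobordism.ofBoundary n W).symm) hg.symm hξs' (hg.isGradientLike_const_sub_neg hξ 1) hβ
  have hcrit : ∀ p, IsMCriticalPt (𝓡∂ (n + 1)) g p → g p < 1 - S.a' := fun p hp => by
    have := (hβg p hp).2
    linarith
  -- the minimum
  have hp₀mem : p₀ ∈ criticalSetOfIndex (𝓡∂ (n + 1)) g 0 := by rw [hp₀]; exact mem_singleton p₀
  have hp₀c : IsMCriticalPt (𝓡∂ (n + 1)) g p₀ := hp₀mem.1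
  have hp₀i : morseIndex (𝓡∂ (n + 1)) g p₀ = 0 := hp₀mem.2
  have huniq : ∀ q, IsMCriticalPt (𝓡∂ (n + 1)) g q → morseIndex (𝓡∂ (n + 1)) g q = 0 → q = p₀ := by
    intro q hq hqi
    have : q ∈ criticalSetOfIndex (𝓡∂ (n + 1)) g 0 := ⟨hq, hqi⟩
    rw [hp₀] at this
    exact this
  have hp₀int : (𝓡∂ (n + 1)).IsInteriorPoint p₀ := hgA.isInteriorPoint_of_isMCriticalPt hp₀c
  have hgp₀ : 0 < g p₀ := by have := (hβg p₀ hp₀c).1; linarith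
  have hgp₀' : g p₀ < 1 - 2 * β := (hβg p₀ hp₀c).2
  -- Milnor's chart at `p₀`
  obtain ⟨φ, hφ, hp₀φ, hgφ, hξφ⟩ :=
    hξ.exists_chart_morseIndex (hg.isMorse.1.of_le (by norm_cast)) hp₀c hp₀int
  rw [hp₀i] at hgφ hξφ
  set u₀ : EuclideanSpace ℝ (Fin (n + 1)) := φ.extend (𝓡∂ (n + 1)) p₀ with hu₀
  have hgφ' : ∀ q ∈ φ.source, g q = g p₀ + ‖φ.extend (𝓡∂ (n + 1)) q - u₀‖ ^ 2 := fun q hq => by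
    rw [hgφ q hq, milnorQuadratic_index_zero]
  have hξφ' : ∀ q ∈ φ.source, mfderiv (𝓡∂ (n + 1)) 𝓘(ℝ, EuclideanSpace ℝ (Fin (n + 1))) (φ.extend (𝓡∂ (n + 1))) q (ξ q) =
      φ.extend (𝓡∂ (n + 1)) q - u₀ := fun q hq => by
    rw [hξφ q hq, milnorModelField_zero_index]
  have htarget : (φ.extend (𝓡∂ (n + 1))).target ∈ 𝓝 u₀ :=
    nhds_of_nhdsWithin_of_nhds
      (range_mem_nhds_extend_of_isInteriorPoint (n := ∞) (by simp) hφ hp₀φ hp₀int)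
      (φ.extend_target_mem_nhdsWithin hp₀φ)
  obtain ⟨r₁, hr₁, hr₁t⟩ := Metric.nhds_basis_closedBall.mem_iff.1 htarget
  -- the open neighbourhood `V` of `p₀` read off the open ball, and the minimum of `g` off `V`
  have hsrc : φ.source = (φ.extend (𝓡∂ (n + 1))).source := (φ.extend_source (I := 𝓡∂ (n + 1))).symm
  set V : Set W := φ.source ∩ φ.extend (𝓡∂ (n + 1)) ⁻¹' ball u₀ r₁ with hV
  have hVo : IsOpen V := by
    have hc : ContinuousOn (φ.extend (𝓡∂ (n + 1))) φ.source := by rw [hsrc]; exact φ.continuousOn_extend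
    exact hc.isOpen_inter_preimage φ.open_source isOpen_ball
  have hpV : p₀ ∈ V := ⟨hp₀φ, by rw [mem_preimage, ← hu₀]; exact mem_ball_self hr₁⟩
  set K : Set W := Vᶜ with hK
  have hKc : IsCompact K := hVo.isClosed_compl.isCompact
  obtain ⟨m₀, hm₀p, hm₀K⟩ : ∃ m₀, g p₀ < m₀ ∧ ∀ q ∈ K, m₀ ≤ g q := by
    rcases K.eq_empty_or_nonempty with hKe | hKne
    · exact ⟨g p₀ + 1, by linarith, fun q hq => by rw [hKe] at hq; exact hq.elim⟩
    · obtain ⟨q₀, hq₀K, hq₀⟩ := hKc.exists_isMinOn hKne hcont.continuousOn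
      have hq₀p : q₀ ≠ p₀ := fun h => hq₀K (h ▸ hpV)
      exact ⟨g q₀, hgA.apply_lt_of_ne_of_index_zero hp₀c huniq hq₀p,
        fun q hq => isMinOn_iff.1 hq₀ q hq⟩
  have hfin : (criticalSet (𝓡∂ (n + 1)) g).Finite := IsMorse.finite_criticalSet_holds hg.isMorse
  obtain ⟨m₁, hm₁p, hm₁⟩ : ∃ m₁, g p₀ < m₁ ∧ ∀ q, IsMCriticalPt (𝓡∂ (n + 1)) g q → q ≠ p₀ → m₁ ≤ g q := by
    rcases (criticalSet (𝓡∂ (n + 1)) g \ {p₀}).eq_empty_or_nonempty with he | hne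
    · refine ⟨g p₀ + 1, by linarith, fun q hq hqp => ?_⟩
      have : q ∈ criticalSet (𝓡∂ (n + 1)) g \ {p₀} := ⟨hq, hqp⟩
      rw [he] at this
      exact this.elim
    · obtain ⟨q₀, hq₀, hmin⟩ := (hfin.sdiff).exists_minimalFor g _ hne
      refine ⟨g q₀, hgA.apply_lt_of_ne_of_index_zero hp₀c huniq hq₀.2, fun q hq hqp => ?_⟩
      by_contra hlt
      push Not at hlt
      exact absurd (hmin ⟨hq, hqp⟩ hlt.le) (not_le.2 hlt)
  -- the radius
  set r : ℝ := min (r₁ / 2) (min 1 (min ((m₀ - g p₀) / 2) (min ((m₁ - g p₀) / 2) β))) with hr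
  have hrpos : 0 < r :=
    lt_min (by linarith) (lt_min one_pos (lt_min (by linarith) (lt_min (by linarith) hβ)))
  have hrr₁ : r < r₁ := (min_le_left _ _).trans_lt (by linarith)
  have hr1 : r ≤ 1 := (min_le_right _ _).trans (min_le_left _ _)
  have hrm : r ≤ (m₀ - g p₀) / 2 :=
    (min_le_right _ _).trans ((min_le_right _ _).trans (min_le_left _ _))
  have hrm₁ : r ≤ (m₁ - g p₀) / 2 :=
    (min_le_right _ _).trans ((min_le_right _ _).trans ((min_le_right _ _).trans (min_le_left _ _)))
  have hrβ : r ≤ β :=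
    (min_le_right _ _).trans ((min_le_right _ _).trans ((min_le_right _ _).trans (min_le_right _ _)))
  have hrsq : r ^ 2 ≤ r := by nlinarith
  have hcm : g p₀ + r ^ 2 < m₀ := by linarith
  have hcm₁ : g p₀ + r ^ 2 < m₁ := by linarith
  have hclevel : g p₀ + r ^ 2 < 1 - S.a' := by linarith
  -- the slab flow
  have ha₀ : 0 < g p₀ / 2 := by linarith
  have hκ : 0 < pushConst * S.a' / 4 := by
    have := pushConst_pos; have := S.a'_pos; positivity
  have hκ' : pushConst * S.a' / 4 ≤ S.a' / 4 := by
    have := pushConst_le_one; have := S.a'_pos; nlinarith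
  have ha₁ : 1 - pushConst * S.a' / 4 < 1 := by linarith
  have ha₀₁ : g p₀ / 2 < 1 - pushConst * S.a' / 4 := by
    have := S.a'_le_eighth; linarith
  obtain ⟨θ, hθ⟩ := hg.exists_slabFlow hξs hξ ha₀ ha₀₁ ha₁
  refine ⟨⟨hg, hξs, hξ, S, hcrit, p₀, by linarith [(hβg p₀ hp₀c).1], hp₀, θ, hθ, φ, hφ, hp₀φ,
    hgφ', hξφ', r, hrpos, ?_, ?_, fun q hq hqp => hcm₁.trans_le (hm₁ q hq hqp), hclevel⟩⟩
  · exact (closedBall_subset_closedBall hrr₁.le).trans hr₁t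
  · -- `{g ≤ g p₀ + r²} ⊆ V ⊆ φ.source`
    intro q hq
    by_contra hqs
    have hqK : q ∈ K := fun hqV => hqs hqV.1
    have := hm₀K q hqK
    simp only [mem_preimage, mem_Iic] at hq
    linarith

/-! ### The minimum, the levels, the sublevel balls -/

variable (B : BasinSetting g ξ)

include B in
/-- `g` is a Morse function adapted to `∂W`. [cite: MilnorHCobordism1965, Def. 3.1] -/
theorem isMorseAdapted : IsMorseAdapted (𝓡∂ (n + 1)) g := B.isMorseFunction.isMorseAdapted_ofBoundary

/-- `p₀` is a critical point of index `0`. [folklore] -/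
theorem p₀_mem_criticalSetOfIndex : B.p₀ ∈ criticalSetOfIndex (𝓡∂ (n + 1)) g 0 := by
  rw [B.criticalSetOfIndex_zero]; exact mem_singleton _

/-- `p₀` is a critical point. [folklore] -/
theorem isMCriticalPt_p₀ : IsMCriticalPt (𝓡∂ (n + 1)) g B.p₀ := B.p₀_mem_criticalSetOfIndex.1

/-- A critical point of index `0` is `p₀`. [folklore] -/
theorem eq_p₀_of_morseIndex_eq_zero {q : W} (hq : IsMCriticalPt (𝓡∂ (n + 1)) g q)
    (hqi : morseIndex (𝓡∂ (n + 1)) g q = 0) : q = B.p₀ := by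
  have : q ∈ criticalSetOfIndex (𝓡∂ (n + 1)) g 0 := ⟨hq, hqi⟩
  rw [B.criticalSetOfIndex_zero] at this
  exact this

/-- **`p₀` is the strict minimum of `g`.** [cite: Milnor1963, proof of Thm. 4.1 (p. 25)] -/
theorem apply_p₀_lt {q : W} (hq : q ≠ B.p₀) : g B.p₀ < g q :=
  B.isMorseAdapted.apply_lt_of_ne_of_index_zero B.isMCriticalPt_p₀
    (fun _ h hi => B.eq_p₀_of_morseIndex_eq_zero h hi) hq

/-- `g p₀ ≤ g q` for every `q`. [cite: Milnor1963, proof of Thm. 4.1 (p. 25)] -/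
theorem apply_p₀_le (q : W) : g B.p₀ ≤ g q := by
  by_cases hq : q = B.p₀
  · rw [hq]
  · exact (B.apply_p₀_lt hq).le

/-- `0 < g p₀` (a Morse function on `(W; ∅, ∂W)` is positive at interior points). [cite: MilnorHCobordism1965, Def. 3.1] -/
theorem apply_p₀_pos : 0 < g B.p₀ :=
  (B.isMorseFunction.2.2.2.2 B.p₀
    (B.isMorseAdapted.isInteriorPoint_of_isMCriticalPt B.isMCriticalPt_p₀)).1

include B in
/-- `0 < g` everywhere. [cite: MilnorHCobordism1965, Def. 3.1] -/
theorem apply_pos (q : W) : 0 < g q := B.apply_p₀_pos.trans_le (B.apply_p₀_le q)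

/-- The collar parameter `a'` is positive. [folklore] -/
theorem a'_pos : 0 < B.S.a' := B.S.a'_pos

/-- The collar parameter `a'` is at most `1/8`. [folklore] -/
theorem a'_le : B.S.a' ≤ 1 / 8 := B.S.a'_le_eighth

/-- **The depth of the push level**: `κ = pushConst · a' / 2`. [cite: Milnor1963, Thm. 3.1] -/
def κ : ℝ := pushConst * B.S.a' / 2

/-- `0 < κ`. [folklore] -/
theorem κ_pos : 0 < B.κ := by
  unfold κ; have := pushConst_pos; have := B.a'_pos; positivity

/-- `κ ≤ a' / 2`. [folklore] -/
theorem κ_le : B.κ ≤ B.S.a' / 2 := by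
  unfold κ; have := pushConst_le_one; have := B.a'_pos; nlinarith

/-- `κ < g p₀ ≤ g q`: every value of `g` exceeds the push depth. [folklore] -/
theorem κ_lt_apply (q : W) : B.κ < g q := by
  have h1 := B.κ_le; have h2 := B.a'_lt_apply_p₀; have h3 := B.apply_p₀_le q; have := B.a'_pos
  linarith

/-- The bottom of the slab is `g p₀ / 2`. [folklore] -/
def lo : ℝ := g B.p₀ / 2

/-- The top of the slab is `1 - κ / 2`. [folklore] -/
def hi : ℝ := 1 - B.κ / 2

/-- The top of the slab, unfolded. [folklore] -/
theorem hi_eq : B.hi = 1 - pushConst * B.S.a' / 4 := by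
  unfold hi κ; ring

/-- The slab flow, with the slab written `[lo, hi]`. [cite: MilnorHCobordism1965, §4 (PDF pp. 21–25)] -/
theorem slabFlow' : SlabFlow (Cobordism.ofBoundary n W) g ξ B.lo B.hi B.θ := by
  rw [hi_eq]; exact B.slabFlow

/-- The pre-slab-flow structure. [cite: MilnorHCobordism1965, §4 (PDF pp. 21–25)] -/
theorem preSlabFlow : PreSlabFlow (Cobordism.ofBoundary n W) g ξ B.lo B.hi B.θ :=
  B.slabFlow'.toPreSlabFlow

/-- The flow is a smooth global flow of the cut-off field. [cite: LeeSmoothManifolds2013, Thm. 9.12] -/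
theorem isSmoothFlow :
    IsSmoothFlow (𝓡∂ (n + 1)) (slabField (c := Cobordism.ofBoundary n W) g ξ B.lo B.hi) B.θ :=
  B.slabFlow'.isSmoothFlow

/-- `lo < g p₀`. [folklore] -/
theorem lo_lt_apply_p₀ : B.lo < g B.p₀ := by unfold lo; linarith [B.apply_p₀_pos]

/-- `lo < g q` for every `q`: the whole manifold lies above the bottom of the slab. [folklore] -/
theorem lo_lt_apply (q : W) : B.lo < g q := B.lo_lt_apply_p₀.trans_le (B.apply_p₀_le q)

/-- **The push level** `L = 1 - κ`. [cite: Milnor1963, Thm. 3.1] -/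
def L : ℝ := 1 - B.κ

/-- `L < hi`. [folklore] -/
theorem L_lt_hi : B.L < B.hi := by unfold L hi; linarith [B.κ_pos]

/-- `hi < 1`. [folklore] -/
theorem hi_lt_one : B.hi < 1 := by unfold hi; linarith [B.κ_pos]

/-- `1 - a' < L`: the push level lies inside the collar, above all critical values. [folklore] -/
theorem one_sub_a'_lt_L : 1 - B.S.a' < B.L := by unfold L; linarith [B.κ_le, B.a'_pos]

/-- Every critical value is `< 1 - a'`, in particular `< L`. [folklore] -/
theorem apply_lt_L_of_isMCriticalPt {p : W} (hp : IsMCriticalPt (𝓡∂ (n + 1)) g p) : g p < B.L :=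
  (B.crit_lt p hp).trans B.one_sub_a'_lt_L

/-- **The level of the chart sphere** `g p₀ + r₀²`. [cite: Milnor1963, proof of Thm. 4.1 (p. 25)] -/
def sph : ℝ := g B.p₀ + B.r₀ ^ 2

/-- `g p₀ < sph`. [folklore] -/
theorem apply_p₀_lt_sph : g B.p₀ < B.sph := by
  unfold sph; exact lt_add_of_pos_right _ (pow_pos B.r₀_pos 2)

/-- `sph < 1 - a' < L`. [folklore] -/
theorem sph_lt_L : B.sph < B.L := B.level_lt.trans B.one_sub_a'_lt_L

/-- The levels of the slab in order: `lo < g p₀ < sph < L < hi < 1`. [folklore] -/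
theorem sph_mem_Ioo : B.sph ∈ Ioo B.lo B.hi :=
  ⟨B.lo_lt_apply_p₀.trans B.apply_p₀_lt_sph, B.sph_lt_L.trans B.L_lt_hi⟩

/-- `L ∈ (lo, hi)`. [folklore] -/
theorem L_mem_Ioo : B.L ∈ Ioo B.lo B.hi :=
  ⟨(B.lo_lt_apply_p₀.trans B.apply_p₀_lt_sph).trans B.sph_lt_L, B.L_lt_hi⟩

/-- **No critical point on the chart sphere level or above it other than above `sph`**: a
critical point `p` with `g p ≤ sph` is `p₀`. [cite: Milnor1963, proof of Thm. 4.1 (p. 25)] -/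
theorem eq_p₀_of_isMCriticalPt_of_le {p : W} (hp : IsMCriticalPt (𝓡∂ (n + 1)) g p) (hle : g p ≤ B.sph) :
    p = B.p₀ := by
  by_contra hne
  exact absurd (B.lt_of_isMCriticalPt p hp hne) (not_lt.2 hle)

/-- The levels in `(g p₀, sph]` carry no critical point. [cite: Milnor1963, proof of Thm. 4.1 (p. 25)] -/
theorem not_isMCriticalPt_of_mem {q : W} (hq : g q ∈ Ioc (g B.p₀) B.sph) :
    ¬ IsMCriticalPt (𝓡∂ (n + 1)) g q := fun hc => by
  have := B.eq_p₀_of_isMCriticalPt_of_le hc hq.2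
  rw [this] at hq
  exact lt_irrefl _ hq.1

/-- The level `L` carries no critical point. [folklore] -/
theorem not_isMCriticalPt_of_eq_L {q : W} (hq : g q = B.L) : ¬ IsMCriticalPt (𝓡∂ (n + 1)) g q := fun hc =>
  absurd (B.apply_lt_L_of_isMCriticalPt hc) (by rw [hq]; exact lt_irrefl _)

end BasinSetting

end Literature.Topology.FourManifolds
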